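import Summits.CriticalPhenomena.PercolationContinuityZ3.Theorems.PercNearOneGluingNoHeavyQuantRootReduction
import Summits.CriticalPhenomena.PercolationContinuityZ3.Theorems.PercNearOneGluingNoHeavyQuantFarTreeLawComb
import HarnessLib

/-!
# QUANT lane R8, FAR on general trees — the root reduction in GATE COORDINATES: a rooted forest with independent vertex
# gates is the root model `RTAIL` whose structures are the trees of the forest; `Quant.FarTreeRow` instance-wise from a
# heavy + sure decomposition (unconditional)

builds on p205010 (kernel theorem, internal audit signed; external expert review pending)

Support file (`--supports stmt-CriticalPhenomena-4575`), QUANT lane typer seat prim-quant-stmt (gen 17), rung R8 of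
`run/shared/lean/prim/quant/LADDER.md`; the gate-coordinate end of T-RED (README V185/V189).  Theorems only, no sorries,
standard axioms.  Inputs: `Quant.LawCombGate.real_lawCount_eq_sum` (p1 g10: block independence of local counts under
`prodBernoulli`), `Quant.RootDec.rtail_ge_of_heavyDec` (this seat, `…QuantRootReduction`).  The conditional companion
(`DEC-certificate ∧ DIB ⟹ FarTreeRow instance`, on `…QuantDIBStar`) follows in a separate file once that statement file is reviewed.

**Setting** (that of `Quant.FarTreeRow`, `…QuantFarTreeRow.lean`, with the index type `E` in place of `Fin m`).  Independent
gates `q : E → [0,1]` (`prodBernoulli q` on `Set E`); relays `A ⊆ E`; relay `a` is REACHED in `ω` when its ancestor set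
`P a` lies in `ω`; `N(ω) = #{a ∈ A : P a ⊆ ω}`.  A labelling `comp : E → κ` that is constant along ancestry on `A`
(`y ∈ P a → comp y = comp a`) splits `A` into STRUCTURES `k` (for a rooted forest: its trees, or any coarser union of trees);
structure `k` reads only the gates of its own fibre, so the structure counts are independent and
`P(N ≥ j+1) = RTAIL[M, μ, j]` with `M k = #{a ∈ A : comp a = k}` and `μ k h = P(#{a ∈ A : comp a = k, P a ⊆ ω} = h)`
(`real_heavy_eq_rtail`).  No forest axiom is needed for the identity.

* `Quant.RootDecGate.card_reached_eq_sum` — `N(ω) = Σ_k N_k(ω)`.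
* `Quant.RootDecGate.real_heavy_eq_rtail` — the identification.
* `Quant.RootDecGate.farTree_of_heavyDec` — **`Quant.FarTreeRow`'s conclusion `P(N ≤ j) ≤ t` for every instance whose
  structure laws admit a heavy + sure two-point decomposition at floor `1 − t`** (credits `cr k` with `Σ cr k > 2j`; for
  `cr k = E N_k` this is FarTreeRow's own budget `2j < Σ_a ∏_{y∈P a} q y`) — unconditional.

[this work]; architecture prim-quant-census-2 g49 ARCH-TREES-G49 (this lane); block independence [cite: Grimmett1999, §2.2];
the gluing rows served [cite: KozmaNitzan2024, Conjecture 3 (p. 15)].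
-/

noncomputable section

namespace Summit.CriticalPhenomena.PercolationContinuityZ3.Theorems

namespace Quant

namespace RootDecGate

open Finset MeasureTheory
open Literature.Probability.LatticeModels
open Literature.Probability.Percolation
open scoped Classical

variable {E : Type*} [Fintype E] {κ : Type} [Fintype κ] [DecidableEq κ]

/-- configurations of structure counts bounded by `M` (as in `…QuantRootReduction`) -/
local notation3 "cfg[" M "]" => Fintype.piFinset (fun k : κ => Finset.range ((M : κ → ℕ) k + 1))

/-- the ROOT tail (as in `…QuantRootReduction`) -/
local notation3 "RTAIL[" M ", " μ ", " j "]" =>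
  ∑ c ∈ cfg[M], (∏ k, (μ : κ → ℕ → ℝ) k ((c : κ → ℕ) k)) * (if (j : ℕ) + 1 ≤ ∑ k, (c : κ → ℕ) k then (1 : ℝ) else 0)

/-- the two-point law `{lo, hi; g}` (as in `…QuantRootReduction`) -/
local notation3 "TP[" lo ", " hi ", " g ", " h "]" =>
  (g : ℝ) * (if (h : ℕ) = (hi : ℕ) then (1 : ℝ) else 0) + (1 - (g : ℝ)) * (if (h : ℕ) = (lo : ℕ) then (1 : ℝ) else 0)

/-- the relays of structure `k` reached in `ω` -/
local notation3 "Nk[" A ", " P ", " comp ", " k ", " ω "]" =>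
  (((A : Finset E).filter fun a => (comp : E → κ) a = k).filter fun a => (((P : E → Finset E) a : Finset E) : Set E) ⊆ (ω : Set E)).card

/-! ### 1. The count splits over the structures -/

omit [Fintype E] in
/-- `N(ω) = Σ_k N_k(ω)`: the reached relays split over the fibres of `comp`. [this work] -/
theorem card_reached_eq_sum (A : Finset E) (P : E → Finset E) (comp : E → κ) (ω : Set E) :
    (A.filter fun a => ((P a : Finset E) : Set E) ⊆ ω).card = ∑ k, Nk[A, P, comp, k, ω] := by
  rw [Finset.card_eq_sum_card_fiberwise (f := comp) (t := Finset.univ) (fun a _ => Finset.mem_univ _)]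
  refine Finset.sum_congr rfl fun k _ => ?_
  rw [Finset.filter_filter, Finset.filter_filter]
  congr 1
  ext a
  simp only [Finset.mem_filter]
  tauto

/-! ### 2. Identification with the root model -/

/-- **A forest with independent gates is the root model.**  For relays `A`, ancestor sets `P` and a labelling `comp` constant
along ancestry on `A`: `P(#{a ∈ A : P a ⊆ ω} ≥ j+1) = RTAIL[M, μ, j]` with `M k = #{a ∈ A : comp a = k}` and `μ k` the law of
`N_k`.  (`Quant.LawCombGate.real_lawCount_eq_sum` with the fibres of `comp` as private gate sets.) [this work] -/
theorem real_heavy_eq_rtail (q : E → unitInterval) (A : Finset E) (P : E → Finset E) (comp : E → κ)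
    (hP : ∀ a ∈ A, ∀ y ∈ P a, comp y = comp a) (j : ℕ) :
    (prodBernoulli q).real {ω : Set E | j + 1 ≤ (A.filter fun a => ((P a : Finset E) : Set E) ⊆ ω).card} =
      RTAIL[(fun k => (A.filter fun a => comp a = k).card),
        (fun k h => (prodBernoulli q).real {ω : Set E | Nk[A, P, comp, k, ω] = h}), j] := by
  -- the event through the structure counts, in the shape of `real_lawCount_eq_sum` (levels `0`, depth `0`)
  have hev : {ω : Set E | j + 1 ≤ (A.filter fun a => ((P a : Finset E) : Set E) ⊆ ω).card} =
      {ω : Set E | j + 1 ≤ ∑ k ∈ Finset.univ.filter (fun _ : κ => (0 : ℕ) ≤ 0), Nk[A, P, comp, k, ω]} := by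
    ext ω
    simp only [Set.mem_setOf_eq]
    rw [card_reached_eq_sum A P comp ω, Finset.filter_true_of_mem fun _ _ => le_refl 0]
  have hGdisj : ∀ k k' : κ, k ≠ k' → Disjoint (Finset.univ.filter fun e : E => comp e = k)
      (Finset.univ.filter fun e : E => comp e = k') := by
    intro k k' hkk'
    rw [Finset.disjoint_filter]
    intro e _ h1 h2
    exact hkk' (h1.symm.trans h2)
  have hloc : ∀ k (ω ω' : Set E), (∀ e ∈ Finset.univ.filter (fun e : E => comp e = k), e ∈ ω ↔ e ∈ ω') →
      Nk[A, P, comp, k, ω] = Nk[A, P, comp, k, ω'] := by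
    intro k ω ω' hagree
    congr 1
    refine Finset.filter_congr fun a ha => ?_
    have hak : comp a = k := (Finset.mem_filter.1 ha).2
    have haA : a ∈ A := (Finset.mem_filter.1 ha).1
    have hy : ∀ y ∈ P a, (y ∈ ω ↔ y ∈ ω') := fun y hy =>
      hagree y (Finset.mem_filter.2 ⟨Finset.mem_univ y, (hP a haA y hy).trans hak⟩)
    constructor
    · intro h y hy'; exact (hy y (Finset.mem_coe.1 hy')).1 (h hy')
    · intro h y hy'; exact (hy y (Finset.mem_coe.1 hy')).2 (h hy')
  have hbd : ∀ k (ω : Set E), Nk[A, P, comp, k, ω] ≤ (A.filter fun a => comp a = k).card :=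
    fun k ω => Finset.card_filter_le _ _
  rw [hev, LawCombGate.real_lawCount_eq_sum q (fun k => Finset.univ.filter fun e : E => comp e = k) hGdisj
    (fun k ω => Nk[A, P, comp, k, ω]) hloc (fun k => (A.filter fun a => comp a = k).card) hbd (fun _ => 0) 0 j]
  refine Finset.sum_congr rfl fun c _ => ?_
  rw [Finset.filter_true_of_mem fun _ _ => le_refl 0]

/-- Complement: `P(N ≤ j) = 1 − P(N ≥ j+1)`. [this work] -/
theorem real_light_eq_one_sub (q : E → unitInterval) (A : Finset E) (P : E → Finset E) (j : ℕ) :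
    (prodBernoulli q).real {ω : Set E | (A.filter fun a => ((P a : Finset E) : Set E) ⊆ ω).card ≤ j} =
      1 - (prodBernoulli q).real {ω : Set E | j + 1 ≤ (A.filter fun a => ((P a : Finset E) : Set E) ⊆ ω).card} := by
  have hc : {ω : Set E | (A.filter fun a => ((P a : Finset E) : Set E) ⊆ ω).card ≤ j} =
      {ω : Set E | j + 1 ≤ (A.filter fun a => ((P a : Finset E) : Set E) ⊆ ω).card}ᶜ := by
    ext ω
    simp only [Set.mem_setOf_eq, Set.mem_compl_iff, not_le]
    omega
  rw [hc, probReal_compl_eq_one_sub MeasurableSet.of_discrete]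

/-! ### 3. FarTreeRow instances from decompositions -/

/-- **`Quant.FarTreeRow` instance-wise from a HEAVY + SURE decomposition (unconditional).**  In the setting above, if every
structure law `μ k` (the law of `N_k` under `prodBernoulli q`) is a mixture `Σ_r λ k r·TP[lo k r, hi k r, g k r]` (`λ ≥ 0`,
`Σ_r λ = 1`, `lo ≤ hi ≤ #{a ∈ A : comp a = k}`) whose genuine components have gates in `[0,1]`, are HEAVY (`1 − t ≤ g`) unless
empty, and carry CREDIT `2·lo + (hi − lo)·g ≥ cr k`, with `2j < Σ_k cr k` and `0 ≤ t`, then `P(N ≤ j) ≤ t`. [this work] -/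
theorem farTree_of_heavyDec {ρ : Type*} [Fintype ρ] [DecidableEq ρ] (q : E → unitInterval) (A : Finset E)
    (P : E → Finset E) (comp : E → κ) (hP : ∀ a ∈ A, ∀ y ∈ P a, comp y = comp a) (j : ℕ) (t : ℝ) (ht : 0 ≤ t)
    (lam : κ → ρ → ℝ) (lo hi : κ → ρ → ℕ) (g : κ → ρ → ℝ) (cr : κ → ℝ)
    (hlam0 : ∀ k r, 0 ≤ lam k r) (hlam1 : ∀ k, ∑ r, lam k r = 1)
    (hμ : ∀ k h, (prodBernoulli q).real {ω : Set E | Nk[A, P, comp, k, ω] = h} =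
      ∑ r, lam k r * TP[lo k r, hi k r, g k r, h])
    (hlohi : ∀ k r, lo k r ≤ hi k r) (hhi : ∀ k r, hi k r ≤ (A.filter fun a => comp a = k).card)
    (hg : ∀ k r, 0 < lam k r → 0 ≤ g k r ∧ g k r ≤ 1)
    (hheavy : ∀ k r, 0 < lam k r → lo k r < hi k r → 1 - t ≤ g k r)
    (hcredit : ∀ k r, 0 < lam k r → cr k ≤ 2 * (lo k r : ℝ) + ((hi k r : ℝ) - lo k r) * g k r)
    (hbudget : (2 * j : ℝ) < ∑ k, cr k) :
    (prodBernoulli q).real {ω : Set E | (A.filter fun a => ((P a : Finset E) : Set E) ⊆ ω).card ≤ j} ≤ t := by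
  have key := RootDec.rtail_ge_of_heavyDec (fun k => (A.filter fun a => comp a = k).card)
    (fun k h => (prodBernoulli q).real {ω : Set E | Nk[A, P, comp, k, ω] = h}) lam lo hi g cr j (1 - t) (by linarith)
    hlam0 hlam1 hμ hlohi hhi hg hheavy hcredit hbudget
  rw [← real_heavy_eq_rtail q A P comp hP j] at key
  rw [real_light_eq_one_sub]
  linarith

end RootDecGate

end Quant

end Summit.CriticalPhenomena.PercolationContinuityZ3.Theorems
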